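import Mathlib
import HarnessLib
import HarnessLib.Audit
import Summits.SmoothPoincare4.Statement
import Literature.Topology.FourManifolds.HomotopySpheres
import Literature.Topology.FourManifolds.ConnectedSum
import Literature.Topology.FourManifolds.GluckTwist
import Literature.Topology.FourManifolds.Knots
import Literature.Geometry.Lorentzian.PseudoRiemannianMetric
import Literature.Geometry.Lorentzian.LeviCivita
import Literature.Geometry.Riemannian.IsotropicCurvature
import Literature.Geometry.Riemannian.ConstantCurvature
import HarnessLib.Audit.Status.Attr

/-!
Route: CartanHadamardSwindle

DORMANT since 2026-08-23T03:12:17Z (reconciler: no traction for 5.9 d (last activity item-evidence-added at 2026-08-17T05:46:27Z); parked, not closed — `ledger route dormant route-SmoothPoincare4-CartanHadamardSwindle --off` to reactiva) — unstaffed, not closed; items shared with open routes are served there. `ledger route dormant <id> --off` reactivates.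

# Route CartanHadamardSwindle — Unroll the host — Farrell–Jones in dimension four; sec ≤ 0 (smooth)
or CAT(0) (cubical) on a hyperbolic Z

X = FJ4 ∧ SCH ("it suffices to show X"), realising card cartan-hadamard-swindle (spine, sole card).
FJ4 = FarrellJonesFour: for every
closed connected hyperbolic 4-manifold X and every homotopy 4-sphere Σ some finite smooth cover Z of
X has a closed connected P ≅ Z # Σ
carrying a Riemannian metric of non-positive sectional curvature — verbatim the n = 4 case of
Farrell–Jones' theorem (n ≥ 5: Z # Σ is even
ε-pinched negatively curved for EVERY exotic Σ), i.e. "non-positive curvature is as blind to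
homotopy-sphere summands in dimension 4 as above it".
UNROLL THE HOST: by Cartan–Hadamard exp flattens the universal cover of P onto ℝ⁴, the simply
connected punctured summand Σ ∖ {p} ⊂ P lifts
into it (COVERING SWINDLE, support), so every homotopy 4-sphere is punctured-standard / invertible
(= crux A of route SchoenfliesSplit), and
SCH = the smooth Schoenflies conjecture — since the 2026-08-15 route-repair this route's OWN crux
SmoothSchoenfliesFour (stmt-10765, rank 6: verbatim the body of the @[conjecture] Literature def
SmoothSchoenfliesConjectureFour, definitionally the shared item stmt-0372 of SchoenfliesSplit /
EuclideanOrigami; not attacked here) — finishes through the frame SchoenfliesFrameFour (stmt-10879,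
twin of SchoenfliesSplit's stmt-0370).
DICHOTOMY the route records: either FJ4 holds and all exoticness of 4-spheres is Schoenflies
exoticness, or some Z # Σ carries no metric with
sec ≤ 0, Σ is exotic, and 4 is the unique dimension in which non-positive curvature detects a
homotopy-sphere summand.
Lean: `(∀ (X : Type) [TopologicalSpace X] [T2Space X] [SecondCountableTopology X] [ChartedSpace
(EuclideanSpace ℝ (Fin 4)) X] [IsManifold (𝓡 4) ∞ X] [CompactSpace X] [ConnectedSpace X] (gX :
Literature.Geometry.Lorentzian.PseudoRiemannianMetric (𝓡 4) ∞ (EuclideanSpace ℝ (Fin 4))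
(TangentSpace (𝓡 4) : X → Type _)), gX.IsRiemannian → gX.HasConstantSectionalCurvature (-1) → ∀ S :
Literature.Topology.FourManifolds.HomotopySphere 4, ∃ (Z P : Type) (_ : TopologicalSpace Z) (_ :
T2Space Z) (_ : SecondCountableTopology Z) (_ : ChartedSpace (EuclideanSpace ℝ (Fin 4)) Z) (_ :
IsManifold (𝓡 4) ∞ Z) (_ : CompactSpace Z) (_ : TopologicalSpace P) (_ : T2Space P) (_ :
SecondCountableTopology P) (_ : ChartedSpace (EuclideanSpace ℝ (Fin 4)) P) (_ : IsManifold (𝓡 4) ∞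
P) (_ : CompactSpace P) (_ : ConnectedSpace P), (∃ c : Z → X, IsCoveringMap c ∧ Function.Surjective
c ∧ IsLocalDiffeomorph (𝓡 4) (𝓡 4) ∞ c) ∧ Literature.Topology.FourManifolds.IsConnectedSum (𝓡 4) (𝓡
4) (𝓡 4) Z S.carrier P ∧ ∃ (g : Literature.Geometry.Lorentzian.PseudoRiemannianMetric (𝓡 4) ∞
(EuclideanSpace ℝ (Fin 4)) (TangentSpace (𝓡 4) : P → Type _)) (cov : CovariantDerivative (𝓡 4)
(EuclideanSpace ℝ (Fin 4)) (TangentSpace (𝓡 4) : P → Type _)), g.IsRiemannian ∧ g.IsLeviCivita cov ∧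
∀ (x : P) (X Y : TangentSpace (𝓡 4) x), g.curvatureForm cov x X Y Y X ≤ 0) ∧
Literature.Topology.FourManifolds.SmoothSchoenfliesConjectureFour`

## Assembly
Pure logic, compiled by the planner (folder Sketch.lean, `assembly_sketch`, lean check rc 0,
2026-08-15): take the hyperbolic X of
ExistsClosedHyperbolicFour; for each Σ, FarrellJonesFour gives Z, P ≅ Z # Σ and (g, cov) with sec ≤
0; CartanHadamardFour gives a smooth
covering ℝ⁴ → P; CoveringSwindle with E = ℝ⁴, ι = id (`Manifold.IsSmoothEmbedding.id`) and
PuncturedSimplyConnected gives one punctured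
embedding Σ ∖ {p} ↪ ℝ⁴, PunctureHomogeneity gives it for all p; with Schoenflies this is the
hypothesis of SchoenfliesFrame, whose conclusion
is SmoothPoincare4.

Rationale: WHY THIS LINE. Every metric route on this summit needs positivity, pinching, entropy or a flow on
the UNKNOWN manifold; this one uses the softest global theorem of Riemannian geometry — the
exponential map of a complete metric with sec ≤ 0 (even merely without conjugate points) is a smooth
covering, Lee2018 Thm 12.8 = Prop 10.20 + Thm 6.23 (READ) — on a KNOWN aspherical host into which
the fake sphere has been summed, and turns Farrell–Jones' high-dimensional phenomenon
(doi:10.1090/s0894-0347-1989-1002632-2; survey doi:10.4310/sdg.2006.v11.n1.a11 Thm 7 READ: for n ≥ 5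
a finite cover Z of any closed hyperbolic X has Z # Σ ε-pinched negatively curved yet ≇ Z, while n =
4 is explicitly set aside because Θₙ is invisible there) into the named dimension-4 bridge FJ4 ⇒ INV
with its dichotomy.
Imported areas: global Riemannian geometry of non-positive curvature (Cartan–Hadamard; the
Farrell–Jones/Ontaneda warping deformation arXiv:1406.1739, READ §0) and, as the discrete rung filed
informally right after open, CAT(0) cubical geometry — Gromov's flag-link criterion, Stone's PL
Cartan–Hadamard doi:10.1090/s0002-9947-1976-0402648-8 with Davis–Januszkiewicz
doi:10.4310/jdg/1214447212 (Davis LMS-32 Thm I.8.4(iii), READ), the Charney–Davis/Davis–Okun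
inequality doi:10.2140/gt.2001.5.7 — legitimate because PL = DIFF in dimension 4 (HirschMazur1974),
which turns "flatten Z # Σ" into a FINITE certificate (a cubulation whose finitely many vertex links
are flag PL 3-spheres).
Planner's sharpening of the card (all recorded in NOTES.md): (i) closed hosts matter only for
closedness-dependent RIGID recognisers — Einstein + BCG doi:10.1007/bf01897050 (Anderson
arXiv:0810.4830 Cor 4.6; the card's DOI 10.1007/BF01896404 is Lück 1994, wrong), Burago–Ivanov
doi:10.1007/bf01896241, sec ≤ 0 on a homotopy T⁴ ⇒ flat (Gromoll–Wolf/Lawson–Yau) — each of which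
merely REWORDS "M # Σ ≅ M" and is deliberately not filed; (ii) with an unpinned cofactor "some sec ≤
0 host absorbs Σ" is equivalent to 𝓟(Σ) by X ≅ (X # Σ) # Σ⁻¹, so every crux PINS the host (finite
covers of a fixed hyperbolic X; T⁴ itself); (iii) cutting a locally symmetric host along a cork
boundary and regluing by an isometry τ of a collar yields only trivial twists (a local isometry of
H⁴ or ℝ⁴ extends to a global one preserving the lifted cork, so τ extends over C), hence FJ4 needs
genuinely variable curvature, exactly as Farrell–Jones' metrics have.
What it does that route SchoenfliesSplit (owner of the frame INV ∧ SCH → SPC4) does not: it gives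
crux A (punctured homotopy spheres embed in ℝ⁴) its first constructive engines and two refutable
intermediates (FarrellJonesFour, TorusAbsorbsGluckTwists) strictly between SPC4 and 𝓟; nothing in
the 23 route files of the sub or in the negatives index (empty) uses aspherical hosts, sec ≤ 0,
CAT(0) or Farrell–Jones.

RANKED CRUXES. #2 CartanHadamardFour (crux) — Cartan–Hadamard in the closed 4-dimensional form the
assembly consumes — the NAMED FACT this line rests on, filed first per the cone rule (to be vendored
as a Literature fact and then threaded as a hypothesis): a compact connected smooth 4-manifold P
carrying a C^∞ Riemannian metric g and a Levi-Civita connection cov of g with Rm(X,Y,Y,X) ≤ 0 for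
all tangent vectors X, Y (non-positive sectional curvature; `curvatureForm`, Lee's sign) admits a
surjective smooth covering map ℝ⁴ → P (exp_p precomposed with a linear isometry ℝ⁴ ≅ T_p P̃; Lee2018
Thm 12.8: exp_p of a complete connected manifold with sec ≤ 0 is a smooth covering, proof = no
conjugate points (Thm 11.12) ⇒ exp_p local diffeomorphism (Prop 10.20) ⇒ covering (Cor 6.20 + Thm
6.23)). [difficulty: XL] (why it might fail: Only by mis-transcription: completeness comes from
compactness, connectedness is essential (ℝ⁴ is connected), the sign must be Lee's Rm(X,Y,Y,X) =
sectional numerator; formalising exp, Jacobi fields and Lee Thm 6.23 over Mathlib is XL, so it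
enters as a cited fact.) [Lee2018, ONeill1983, doi:10.1007/978-3-319-91755-9]
#3 FarrellJonesFour (crux) — FARRELL–JONES IN DIMENSION FOUR (the card's bridge FJ4 in the
pinned-host form that is not a rewording of 𝓟): for every closed connected hyperbolic 4-manifold X
(Riemannian, constant sectional curvature −1) and every homotopy 4-sphere Σ there are a finite
smooth cover Z → X (covering map, surjective, local diffeomorphism; Z compact) and a closed
connected P which is a connected sum Z # Σ and carries a Riemannian metric g with a Levi-Civita
connection of non-positive sectional curvature. SPC4 ⇒ FJ4 (Z = X, P ≅ X); FJ4 ⇒ 𝓟(Σ) for all Σ by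
CartanHadamardFour + CoveringSwindle; because Z is pinned (a cover of the given X) the cheap
converse 𝓤(Σ) ⇒ "X ≅ (X # Σ) # Σ⁻¹ is a host" does not apply. Constructive content = the two-layer
plan: a Farrell–Jones neck along a CORK boundary instead of a geodesic sphere. [deps:
CartanHadamardFour] [difficulty: open-problem] (why it might fail: The FJ warping reglues across a
geodesic 3-sphere, i.e. realises only twisted spheres (all standard, Γ₄ = 0); a cork neck needs sec
≤ 0 on a contractible non-ball C with non-convex τ-isometric collar — impossible in locally
symmetric backgrounds, and false iff some Σ is a non-unit.) [doi:10.1090/s0894-0347-1989-1002632-2,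
doi:10.4310/sdg.2006.v11.n1.a11, arXiv:1406.1739, doi:10.2307/2160446, arXiv:math/0402173]
#4 TorusAbsorbsGluckTwists (crux) — THE TORUS TEST (card item TORUS-GLUCK): for every 2-knot K,
every Gluck twist X = Σ_K of S⁴ along K and every connected P which is a connected sum T⁴ # X (T⁴ =
(S¹×S¹)×(S¹×S¹), product smooth structure, model ((𝓡 1).prod (𝓡 1)).prod ((𝓡 1).prod (𝓡 1))), P ≅
T⁴. The simplest PINNED-host absorption statement: implied by the Gluck twist conjecture (Σ_K ≅ S⁴ ⇒
P ≅ T⁴ # S⁴ ≅ T⁴), it implies 𝓟(Σ_K) for every K (CoveringSwindle with the flat covering ℝ⁴ → T⁴),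
and unlike Σ_K # S²×S² ≅ S²×S², Σ_K # ℂP² ≅ ℂP² (Gluck1962) the host has π₂ = 0 — no sphere to
dissolve against. Also the natural first target of the cubical rung (T⁴'s product cubulation,
explicit triangulations of Σ_K), in the Charney–Davis-extremal regime χ = 0. [difficulty:
open-problem] (why it might fail: Refutable only by an exotic Gluck twist (then SPC4 dies too);
provable today only where Σ_K ≅ S⁴ is already known (twist-spun, Gordon1976; ribbon; 0-concordant) —
T⁴'s 1- and 2-handles offer no dissolving move, so it may be exactly Gluck-hard with nothing
gained.) [Gluck1962, Gordon1976, Kirby1997, FreedmanGompfMorrisonWalker2010]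
#6 SmoothSchoenfliesFour (crux) — the smooth 4-dimensional Schoenflies conjecture (equator form,
Kirby1997 Problem 4.32), conjunct B of X, inlined verbatim from the @[conjecture] Literature def
`Literature.Topology.FourManifolds.SmoothSchoenfliesConjectureFour` so that the open conjecture is
this route's own listed crux (conjecture rule) — definitionally equal to it and hence to the shared
item stmt-SmoothPoincare4-0372 (proofs/refutations transfer by `id`; certificate
TwinCertificates.lean in the route evidence). Lowest crux rank: this route does not attack it.
[difficulty: open-problem] (why it might fail: open since 1959, 'wide open' (Kirby1989 p.14); a
smooth S³ ⊂ S⁴ whose Schoenflies ball has no genus-≤2 / 3-handle-free structure may be exotic;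
proved cases only Scharlemann1984, Gompf1991Killing.) [Kirby1997, Mazur1959, Scharlemann1984,
Gompf1991Killing, BudneyGabai2019]
#9 CoveringSwindle (support) — THE COVERING SWINDLE (card Lemma 1, host class widened): if P is a
connected sum M # Σ of a Hausdorff ℝ⁴-charted M and a homotopy 4-sphere Σ, and P admits a smooth
covering map π : E → P from a smooth 4-manifold E that smoothly embeds in ℝ⁴ (E = ℝ⁴: aspherical
hosts; E = ℝ⁴ ∖ 0 ≅ S³×ℝ: the Hopf host S¹×S³ of card hopf-stabilisation-kodaira; E = ℝ⁴ ∖ line ≅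
S²×ℝ²: hosts S²×T², S²×Σ_g), then some punctured copy Σ ∖ {p} smoothly embeds in ℝ⁴. Proof: the
punctured summand is an open subset of P (IsOpenGluing), simply connected (hypothesis, =
PuncturedSimplyConnected) and locally path connected, so its inclusion lifts through π (Mathlib
`IsCoveringMap.existsUnique_continuousMap_lifts`); the lift is injective, open and locally (smooth
local inverse of π) ∘ (inclusion), hence a smooth embedding into E; compose with ι. [difficulty:
provable-now] [Hatcher2002, KervaireMilnor1963,
Mathlib:IsCoveringMap.existsUnique_continuousMap_lifts]
#9 PuncturedSimplyConnected (support) — for every homotopy 4-sphere Σ and p ∈ Σ the open submanifold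
Σ ∖ {p} is simply connected (π₁(S⁴) = 1, Hatcher2002 Prop 1.14; deleting a point from a manifold of
dimension ≥ 3 does not change π₁ — transversality, or van Kampen for Σ = (Σ ∖ {p}) ∪ chart ball).
Known; cite-level if Mathlib lacks π₁(Sⁿ) = 1. [difficulty: M] [Hatcher2002, Hirsch1976]
#9 PunctureHomogeneity (support) — if Σ ∖ {p} smoothly embeds in ℝ⁴ for one point p then it does for
every point q (precompose with a diffeomorphism of Σ taking q to p — homogeneity of connected
manifolds, Milnor1965 §4; in tree the disc-theorem family
`Literature.Topology.FourManifolds.exists_diffeomorph_apply_eq_forall_isOrientationPreserving_cs`,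
connectedness of Σ from Σ ≃ₕ S⁴). [difficulty: provable-now] [Milnor1965, Palais1960]
#9 ExistsClosedHyperbolicFour (support) — there is a closed connected smooth 4-manifold with a
Riemannian metric of constant sectional curvature −1 (Davis 1985, the 120-cell manifold, χ = 26;
Ratcliffe–Tschantz). Needed only to instantiate the host in the assembly; a cite-level named fact (a
Lean construction would pass through a torsion-free subgroup of the right-angled 120-cell Coxeter
group). [difficulty: L] [doi:10.2307/2044771, doi:10.1016/s0166-8641(99)00221-7]
#9 SchoenfliesFrameFour (support) — (every punctured homotopy 4-sphere smoothly embeds in ℝ⁴) ∧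
SmoothSchoenfliesFour → SmoothPoincare4: the twin of SchoenfliesSplit's frame
stmt-SmoothPoincare4-0370 with the Literature constant replaced by the route's crux (either follows
from the other by `fun h hx => h ⟨hx.1, hx.2⟩`). Content as there: the chart-sphere image bounds a
Schoenflies ball; SCH makes it a ball; Σ = B⁴ ∪_φ B⁴ is a twisted sphere; Cerf Γ₄ = 0 (tree:
cerf_twistedSphere_four, Theorems/SchoenfliesSplitAssembly.lean); packaging into the summit binder
via SchoenfliesSplit's typed pieces (0517, 0445, 0441). Not elementary. [difficulty: L] [Cerf1968,
Palais1960, Kirby1997, KervaireMilnor1963]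

TWO-LAYER PLAN. Foreseen glued splits (nothing filed now; k ≤ 3, depth 1).
(a) FarrellJonesFour ⇐ CorkTwistCovers → CorkFlattening → FarrellJonesFour. CorkTwistCovers = every
homotopy 4-sphere is a cork twist
S⁴_{C,τ} (h-cobordant to S⁴: KervaireMilnor1963, Wall1964; cork theorem
CurtisFreedmanHsiangStong1996, Matveyev1996, tree
`Literature.Topology.FourManifolds.Matveyev1996_decomposition`). CorkFlattening = for every cork (C,
τ) ⊂ B⁴ and closed hyperbolic X: a finite
cover Z ⊃ B⁴ ⊃ C and metrics g_C on C, g_V on Z ∖ C̊, both sec ≤ 0, whose boundary ∞-jets agree AND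
are τ-invariant — then Z = C ∪_id V and
Z # Σ = C ∪_τ V inherit sec ≤ 0 simultaneously; the Farrell–Jones neck with the round S³ replaced by
the cork boundary Y = ∂C (hyperbolic,
τ ∈ Isom(Y) by Mostow); C must be metrically asymmetric inside and non-convex at ∂C, and the
background must have variable curvature (planner's
lemma (iii)).
(b) THE DISCRETE RUNG, informal crux CubicalFarrellJonesFour (filed right after open, rank 5) ⇐
StonePLCartanHadamard (cite: a complete CAT(0)
piecewise-Euclidean PL 4-manifold is PL-homeomorphic to ℝ⁴; doi:10.1090/s0002-9947-1976-0402648-8,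
Davis LMS-32 Thm I.8.4(iii)) →
PLisDIFFfour (cite: HirschMazur1974) → CoveringSwindle: a locally CAT(0) cubulation of Z # Σ (all
vertex links flag PL 3-spheres) gives 𝓟(Σ).
(c) TorusAbsorbsGluckTwists ⇐ known-standard sector (twist-spun, ribbon: Gordon1976) → general K,
only if a T⁴-specific move appears.
(d) CartanHadamardFour is never split: vendored as a Literature fact and the assembly restated with
`(h : fact) →`.

KILL CRITERIA. An exotic homotopy 4-sphere that is NOT a unit (¬𝓟) refutes FarrellJonesFour,
TorusAbsorbsGluckTwists and the cubical crux at once — close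
`refuted:FarrellJonesFour`. A theorem "hyperbolic Z, Z # Σ admits sec ≤ 0 ⇒ Z # Σ ≅ Z" (smooth
rigidity (1.7) of FJO2006 in dimension 4 for
sums) does not kill the line but collapses FJ4 to cancellation "Z # Σ ≅ Z" — pivot the engine to the
cubical rung or close `superseded --by
route-SmoothPoincare4-SchoenfliesSplit`. CorkFlattening shown impossible by a curvature obstruction
for a cork whose twist is KNOWN to be S⁴
(the Akbulut–Mazur cork in its doubled position, AkbulutKirby1979) kills construction (a): keep FJ4
as a bridge, staff only (b). A proof that
FJ4 with its pinned cover is equivalent to 𝓟 by bookkeeping alone (see Cheapest falsifier) ⇒ merge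
into SchoenfliesSplit as support and close
`superseded`. 𝓟 for all Σ proved elsewhere (SchoenfliesSplit crux A), or SPC4 proved anywhere, moots
the route.

NOT DECOMPOSED YET. CorkFlattening and CorkTwistCovers (children of FarrellJonesFour, plan (a)); the
cite facts StonePLCartanHadamard, PLisDIFFfour, Gromov's flag
criterion and the TYPED form of the cubical crux (no PL / cube-complex / CAT(0) vocabulary in the
tree — definition request D1); the
no-conjugate-points and pole variants of CartanHadamardFour (same conclusion, weaker hypothesis —
file only when a constructor for such metrics
appears); the Einstein/BCG, Burago–Ivanov, Colding-b₁ and Kähler rungs (rigid rewordings of "M # Σ ≅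
M", deliberately NOT filed); the
negative horn "∃ hyperbolic X, Σ with every cover Z # Σ carrying no sec ≤ 0 metric" (needs an exotic
non-unit Σ plus an obstruction —
refuter territory); ε-pinching (FJ's stronger conclusion) and Anosov-geodesic-flow variants.

CHEAPEST FALSIFIER. Run by the planner: (1) literature — FJO2006 (READ Thm 7, pp. 335–338) and
Farrell–Ontaneda arXiv:math/0402173 treat n ≥ 5 and set n = 4
aside (Θₙ-based template); Ontaneda arXiv:1406.1739 (READ §0) confirms the warping deformation
reglues across a geodesic SPHERE; no dimension-4
statement of FJ4 in either direction surfaced in the § Novelty queries; (2) the isometric-collar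
computation (Why this line (iii)) kills the
naive constant-curvature construction — recorded, not fatal. Cheapest remaining checks for a
refuter: (α) decide whether FarrellJonesFour with
its pinned cover is ALREADY equivalent to 𝓟 by a cancellation trick subtler than X ≅ (X # Σ) # Σ⁻¹
(note a d-fold cover of Z # Σ is
Z' # dΣ) — if yes the crux rewords SchoenfliesSplit's crux A and the route should be merged there;
(β) for the cubical crux, enumerate the flag
PL 3-spheres with ≤ 10 vertices in the Charney–Davis equality case κ(L) = 0 (kit;
small-triangulation census arXiv:2412.04768 for host data) —
if only joins C₄ * C_n occur, locally CAT(0) cubulations of χ = 0 hosts are product-like and the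
torus sector of the cubical rung is dead on
arrival (use χ > 0 hyperbolic hosts).

NUMBERS. χ(T⁴ # Σ) = 0, so a locally CAT(0) cubulation of it has Σ_v κ(Lk v) = 0 with every κ(Lk v)
≥ 0 (Charney–Davis for flag 3-spheres,
doi:10.2140/gt.2001.5.7), i.e. every link in the equality case; κ(C_m * C_n) = (1 − m/4)(1 − n/4)
(planner's computation; the octahedral
link C₄ * C₄ of the cubical T⁴ has κ = 0); χ(Davis hyperbolic 4-manifold) = 26
(doi:10.2307/2044771), so hyperbolic hosts leave room Σ κ = 26 −
0·(#Σ-vertices). Farrell–Jones pinching: sec within ε of −1 once the warping happens on t ∈ [α, 2α]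
with α > α₀(ε) inside an embedded ball of
radius 2α (arXiv:1406.1739 §0) — hence the finite covers. Items at open: 10 (1 assembly, 3 cruxes, 6
support) + 1 informal crux after open; after the 2026-08-15 route-repair: 11 active (1 assembly, 4
cruxes incl. SmoothSchoenfliesFour, 5 support + 1 informal), deciding theorem `closes` proved over
the 8 typed non-assembly items.

DEFINITION REQUESTS. D1 `IsLocallyCATZeroCubulation` (topic Literature/Geometry/MetricGeometry): a
finite cube-complex structure on a compact PL (= smooth, dimension 4)
manifold all of whose vertex links are flag simplicial complexes, together with the cite facts
Gromov1987 §4.2.C (flag links ⇔ locally CAT(0)),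
Stone1976 / Davis LMS-32 Thm I.8.4(iii) (PL Cartan–Hadamard) and HirschMazur1974 (PL = DIFF in
dimension ≤ 6) — needed to TYPE
CubicalFarrellJonesFour; filed with `--kind definition` after open. Cite facts wanted:
Cartan–Hadamard (Lee2018 Thm 12.8) = crux 2; Davis 1985
closed hyperbolic 4-manifold = ExistsClosedHyperbolicFour; π₁ of punctured homotopy 4-spheres =
PuncturedSimplyConnected. No new definition is
needed for the typed items (IsConnectedSum, IsGluckTwist, HomotopySphere,
PseudoRiemannianMetric.curvatureForm / IsLeviCivita /
HasConstantSectionalCurvature, Mathlib IsCoveringMap / IsLocalDiffeomorph / SimplyConnectedSpace all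
exist; Sketch.lean rc 0).

Novelty: Searches (2026-08-15): `lit search --hybrid "Farrell Jones negatively curved manifolds exotic smooth
structures connected sum exotic sphere"` (8 held books; Greene–Yau PSPUM 54 cites FJ1989; no n = 4
treatment); `lit search "Farrell Jones Ontaneda negative curvature exotic topology survey"` (local 2
incl. arXiv:math/0402173 + remote 15; FJO2006 doi:10.4310/sdg.2006.v11.n1.a11 fetched and READ pp.
7–10); `lit galaxy search --star all` for "exotic aspherical 4-manifold" (0), "fake 4-torus" (0),
"exotic smooth structure on the 4-torus" (0), "Farrell-Jones warping" (1: arXiv:1406.1739, READ §0),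
"negatively curved exotic" (2: Davis LMS-32 isbn 9780691131382 — in-book reads of Thm I.8.4 and
notes I.8 on Stone's theorem —, arXiv:1406.1739); `lit search --hybrid "Cartan-Hadamard complete
simply connected nonpositive sectional curvature exponential map covering"` (Lee2018 Thm 12.8 READ
pp. 356–357); crossref lookups Stone1976 doi:10.1090/s0002-9947-1976-0402648-8,
DavisJanuszkiewicz1991 doi:10.4310/jdg/1214447212, DavisOkun2001 doi:10.2140/gt.2001.5.7,
BuragoIvanov1994 doi:10.1007/bf01896241, BessonCourtoisGallot1995 doi:10.1007/bf01897050 (the card's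
and its audit's DOI 10.1007/BF01896404 resolves to Lück 1994 — wrong), Davis1985
doi:10.2307/2044771; `lit frontier SmoothPoincare4 --since 2020` (30 rows; arXiv:2412.04768
triangulation census relevant to the cubical crux; nothing on non-positive curvature); `lit bridges
SmoothPoincare4 --cross any` (noise only); `ledger negatives --pr  [refs: 10.4310/sdg.2006.v11.n1.a11, 10.1090/s0002-9947-1976-0402648-8, 10.4310/jdg/1214447212, 10.2140/gt.2001.5.7, 10.1007/bf01896241, 10.1007/bf01897050, 10.1007/BF01896404, 10.2307/2044771, 10.1090/s0894-0347-1989-1002632-2, math/0402173, 1406.1739, 2412.04768, 0810.4830, doi:10.4310/sdg.2006.v11.n1.a11, doi:10.1090/s0002-9947-1976-0402648-8, doi:10.4310/jdg/1214447212, doi:10.2140/gt.2001.5.7, doi:10]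

Barriers (technique_class: aspherical-host, cartan-hadamard, cat0-cubulation): - technique_class: aspherical-host, cartan-hadamard, cat0-cubulation
- Literature.Barriers.SmoothPoincare4.OpenAnalogueBarrierFour: respected — the swindle concludes
only that Σ ∖ {p} EMBEDS in ℝ⁴ (𝓟); "≅ ℝ⁴" is obtained geometrically (exp_p a diffeomorphism) or by
the compactness-sensitive Mazur/Cerf argument 𝓟 ⇔ 𝓤, never from "embeds + homeomorphic".
- Literature.Barriers.SmoothPoincare4.StableBarrierFour: evaded structurally — an aspherical host
has π₂ = 0, there is nothing to dissolve against, and absorption by it implies 𝓟 (CoveringSwindle),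
which absorption by S²×S² does not.
- Literature.Barriers.SmoothPoincare4.GluckTwistCP2Barrier: same — TorusAbsorbsGluckTwists is
absorption WITHOUT a ±1-sphere; no ℂP²-cancellative invariant is used.
- Literature.Barriers.SmoothPoincare4.TopologicalBarrierFour: Freedman's Z # Σ ≈ Z only NAMES the
smoothings FJ4 speaks about; every recogniser outputs a covering/diffeomorphism from a metric or a
cubulation of the smooth (= PL) structure, never from the topological type.
- Literature.Barriers.SmoothPoincare4.TwistedSphereBarrierFour: conceded for the original template —
the Farrell–Jones warping reglues across a geodesic 3-sphere, i.e. realises only twisted spheres,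
all standard (Γ₄ = 0); the bet is the cork neck (plan (a)) or the cubical rung (plan (b)).
- Literature.Barriers.SmoothPoincare4.HCobordismBarrierFour: not used — no h-cobordism or
handle-cancellation argument; corks enter only as the support of the regluing.
- Literature.B

Novelty grade: new-combination — ROUTE REVIEW (refuter rreview-63142eff-0; full text + ADDENDUM = route evidence REVIEW-CartanHadamardSwindle.md). VERDICT keep open. 8/8 decls elaborate (W3.lean rc0); Assembly concludes SmoothPoincare4 by name; not a recombination of closed SPC4 routes. JUNK CHECK passed: although cov.curvature is  (refuter refuter-rreview-route-Parity-TwoCMLines--63142eff-0, 2026-08-15T14:00:27Z; prior: doi:10.1090/s0894-0347-1989-1002632-2, doi:10.4310/sdg.2006.v11.n1.a11, arXiv:math/0402173, arXiv:1406.1739, arXiv:2411.19400, doi:10.4310/jdg/1214460798, doi:10.2307/2160446, doi:10.2307/2044771, doi:10.1090/s0002-9947-1976-0402648-8, doi:10.4310/jdg/1214447212, route-SmoothPoincare4-SchoenfliesSplit)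

History (route lifecycle, newest last):
- 2026-08-15T16:54:39Z · rev 7: restated Assembly (stmt-SmoothPoincare4-8102) — route-repair (cone guardrail, re-route around the undeclared-conjecture dep): the shared items Schoenflies (stmt-0372 := Literature…SmoothSchoenfliesConjectureF (planner-rbadge-SmoothPoincare4-CartanHadamardS-f5b59cf8-g4-0)
- 2026-08-15T16:54:39Z · rev 7: dropped Schoenflies, SchoenfliesFrame — route-repair (cone guardrail, re-route around the undeclared-conjecture dep): the shared items Schoenflies (stmt-0372 := Literature…SmoothSchoenfliesConjectureF (planner-rbadge-SmoothPoincare4-CartanHadamardS-f5b59cf8-g4-0)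
- 2026-08-23T03:12:17Z · DORMANT — reconciler: no traction for 5.9 d (last activity item-evidence-added at 2026-08-17T05:46:27Z); parked, not closed — `ledger route dormant route-SmoothPoincare4- (operator:999:1705194)

sub-problem: SmoothPoincare4 · status: dormant · opened planner-plancard-SmoothPoincare4-SmoothPoinca-85c4eb56-0 2026-08-15T12:27:30Z · rev 8 · ledger route-SmoothPoincare4-CartanHadamardSwindle
GENERATED by the gate from the ledger (D-0016/17). Provers cite these decls: `theorem foo : Summit.SmoothPoincare4.SmoothPoincare4.Theses.CartanHadamardSwindle.<Decl> := …` in Summits/SmoothPoincare4/SmoothPoincare4/Theorems/<Name>.lean.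
-/

namespace Summit.SmoothPoincare4.SmoothPoincare4.Theses.CartanHadamardSwindle

open scoped BigOperators Topology Manifold Classical MeasureTheory ProbabilityTheory Matrix InnerProductSpace ComplexConjugate ContinuousMap ContDiff
open Filter Set Function TopologicalSpace MeasureTheory

attribute [summit_statement] _root_.SmoothPoincare4

open Literature.SPC4

/-- item stmt-SmoothPoincare4-8095 · crux · rank 2 · open · by planner
why it might fail: Only by mis-transcription: completeness comes from compactness, connectedness is essential (ℝ⁴ is connected), the sign must be Lee's Rm(X,Y,Y,X) = sectional numerator; formalising exp, Jacobi fields and Lee Thm 6.23 over Mathlib is XL, so it enters as a cited fact.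
sources: Lee2018, ONeill1983, doi:10.1007/978-3-319-91755-9
[crux] Cartan–Hadamard in the closed 4-dimensional form the assembly consumes — the NAMED FACT this
line rests on, filed first per the cone rule (to be vendored as a Literature fact and then threaded
as a hypothesis): a compact connected smooth 4-manifold P carrying a C^∞ Riemannian metric g and a
Levi-Civita connection cov of g with Rm(X,Y,Y,X) ≤ 0 for all tangent vectors X, Y (non-positive
sectional curvature; `curvatureForm`, Lee's sign) admits a surjective smooth covering map ℝ⁴ → P
(exp_p precomposed with a linear isometry ℝ⁴ ≅ T_p P̃; Lee2018 Thm 12.8: exp_p of a complete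
connected manifold with sec ≤ 0 is a smooth covering, proof = no conjugate points (Thm 11.12) ⇒
exp_p local diffeomorphism (Prop 10.20) ⇒ covering (Cor 6.20 + Thm 6.23)). [difficulty: XL] -/
@[route_item "route-SmoothPoincare4-CartanHadamardSwindle", crux]
def CartanHadamardFour : Prop :=
  ∀ (P : Type) [TopologicalSpace P] [T2Space P] [SecondCountableTopology P] [ChartedSpace (EuclideanSpace ℝ (Fin 4)) P] [IsManifold (𝓡 4) ∞ P] [CompactSpace P] [ConnectedSpace P] (g : Literature.Geometry.Lorentzian.PseudoRiemannianMetric (𝓡 4) ∞ (EuclideanSpace ℝ (Fin 4)) (TangentSpace (𝓡 4) : P → Type _)) (cov : CovariantDerivative (𝓡 4) (EuclideanSpace ℝ (Fin 4)) (TangentSpace (𝓡 4) : P → Type _)), g.IsRiemannian → g.IsLeviCivita cov → (∀ (x : P) (X Y : TangentSpace (𝓡 4) x), g.curvatureForm cov x X Y Y X ≤ 0) → ∃ π : EuclideanSpace ℝ (Fin 4) → P, IsCoveringMap π ∧ Function.Surjective π ∧ IsLocalDiffeomorph (𝓡 4) (𝓡 4) ∞ π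

/-- item stmt-SmoothPoincare4-8096 · crux · rank 3 · open · by planner
why it might fail: The FJ warping reglues across a geodesic 3-sphere, i.e. realises only twisted spheres (all standard, Γ₄ = 0); a cork neck needs sec ≤ 0 on a contractible non-ball C with non-convex τ-isometric collar — impossible in locally symmetric backgrounds, and false iff some Σ is a non-unit.
sources: doi:10.1090/s0894-0347-1989-1002632-2, doi:10.4310/sdg.2006.v11.n1.a11, arXiv:1406.1739, doi:10.2307/2160446, arXiv:math/0402173
[crux] FARRELL–JONES IN DIMENSION FOUR (the card's bridge FJ4 in the pinned-host form that is not a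
rewording of 𝓟): for every closed connected hyperbolic 4-manifold X (Riemannian, constant sectional
curvature −1) and every homotopy 4-sphere Σ there are a finite smooth cover Z → X (covering map,
surjective, local diffeomorphism; Z compact) and a closed connected P which is a connected sum Z # Σ
and carries a Riemannian metric g with a Levi-Civita connection of non-positive sectional curvature.
SPC4 ⇒ FJ4 (Z = X, P ≅ X); FJ4 ⇒ 𝓟(Σ) for all Σ by CartanHadamardFour + CoveringSwindle; because Z
is pinned (a cover of the given X) the cheap converse 𝓤(Σ) ⇒ "X ≅ (X # Σ) # Σ⁻¹ is a host" does not
apply. Constructive content = the two-layer plan: a Farrell–Jones neck along a CORK boundary instead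
of a geodesic sphere. [deps: CartanHadamardFour] [difficulty: open-problem] -/
@[route_item "route-SmoothPoincare4-CartanHadamardSwindle", crux]
def FarrellJonesFour : Prop :=
  ∀ (X : Type) [TopologicalSpace X] [T2Space X] [SecondCountableTopology X] [ChartedSpace (EuclideanSpace ℝ (Fin 4)) X] [IsManifold (𝓡 4) ∞ X] [CompactSpace X] [ConnectedSpace X] (gX : Literature.Geometry.Lorentzian.PseudoRiemannianMetric (𝓡 4) ∞ (EuclideanSpace ℝ (Fin 4)) (TangentSpace (𝓡 4) : X → Type _)), gX.IsRiemannian → gX.HasConstantSectionalCurvature (-1) → ∀ S : Literature.Topology.FourManifolds.HomotopySphere 4, ∃ (Z P : Type) (_ : TopologicalSpace Z) (_ : T2Space Z) (_ : SecondCountableTopology Z) (_ : ChartedSpace (EuclideanSpace ℝ (Fin 4)) Z) (_ : IsManifold (𝓡 4) ∞ Z) (_ : CompactSpace Z) (_ : TopologicalSpace P) (_ : T2Space P) (_ : SecondCountableTopology P) (_ : ChartedSpace (EuclideanSpace ℝ (Fin 4)) P) (_ : IsManifold (𝓡 4) ∞ P) (_ : CompactSpace P) (_ : ConnectedSpace P),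 (∃ c : Z → X, IsCoveringMap c ∧ Function.Surjective c ∧ IsLocalDiffeomorph (𝓡 4) (𝓡 4) ∞ c) ∧ Literature.Topology.FourManifolds.IsConnectedSum (𝓡 4) (𝓡 4) (𝓡 4) Z S.carrier P ∧ ∃ (g : Literature.Geometry.Lorentzian.PseudoRiemannianMetric (𝓡 4) ∞ (EuclideanSpace ℝ (Fin 4)) (TangentSpace (𝓡 4) : P → Type _)) (cov : CovariantDerivative (𝓡 4) (EuclideanSpace ℝ (Fin 4)) (TangentSpace (𝓡 4) : P → Type _)), g.IsRiemannian ∧ g.IsLeviCivita cov ∧ ∀ (x : P) (X Y : TangentSpace (𝓡 4) x), g.curvatureForm cov x X Y Y X ≤ 0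

/-- item stmt-SmoothPoincare4-8097 · crux · rank 4 · open · by planner
why it might fail: Refutable only by an exotic Gluck twist (then SPC4 dies too); provable today only where Σ_K ≅ S⁴ is already known (twist-spun, Gordon1976; ribbon; 0-concordant) — T⁴'s 1- and 2-handles offer no dissolving move, so it may be exactly Gluck-hard with nothing gained.
sources: Gluck1962, Gordon1976, Kirby1997, FreedmanGompfMorrisonWalker2010
[crux] THE TORUS TEST (card item TORUS-GLUCK): for every 2-knot K, every Gluck twist X = Σ_K of S⁴
along K and every connected P which is a connected sum T⁴ # X (T⁴ = (S¹×S¹)×(S¹×S¹), product smooth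
structure, model ((𝓡 1).prod (𝓡 1)).prod ((𝓡 1).prod (𝓡 1))), P ≅ T⁴. The simplest PINNED-host
absorption statement: implied by the Gluck twist conjecture (Σ_K ≅ S⁴ ⇒ P ≅ T⁴ # S⁴ ≅ T⁴), it
implies 𝓟(Σ_K) for every K (CoveringSwindle with the flat covering ℝ⁴ → T⁴), and unlike Σ_K # S²×S²
≅ S²×S², Σ_K # ℂP² ≅ ℂP² (Gluck1962) the host has π₂ = 0 — no sphere to dissolve against. Also the
natural first target of the cubical rung (T⁴'s product cubulation, explicit triangulations of Σ_K),
in the Charney–Davis-extremal regime χ = 0. [difficulty: open-problem] -/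
@[route_item "route-SmoothPoincare4-CartanHadamardSwindle"]
def TorusAbsorbsGluckTwists : Prop :=
  ∀ (K : Literature.Topology.FourManifolds.TwoKnot) (X : Type) [TopologicalSpace X] [T2Space X] [SecondCountableTopology X] [ChartedSpace (EuclideanSpace ℝ (Fin 4)) X] [IsManifold (𝓡 4) ∞ X] (P : Type) [TopologicalSpace P] [T2Space P] [SecondCountableTopology P] [ChartedSpace (EuclideanSpace ℝ (Fin 4)) P] [IsManifold (𝓡 4) ∞ P] [ConnectedSpace P], Literature.Topology.FourManifolds.IsGluckTwist (𝓡 4) X K → Literature.Topology.FourManifolds.IsConnectedSum (𝓡 4) (((𝓡 1).prod (𝓡 1)).prod ((𝓡 1).prod (𝓡 1))) (𝓡 4) ((↥(Metric.sphere (0 : EuclideanSpace ℝ (Fin 2)) 1) × ↥(Metric.sphere (0 : EuclideanSpace ℝ (Fin 2)) 1)) × (↥(Metric.sphere (0 : EuclideanSpace ℝ (Fin 2)) 1) × ↥(Metric.sphere (0 : EuclideanSpace ℝ (Fin 2)) 1))) X P → Nonempty (P ≃ₘ⟮𝓡 4, ((𝓡 1).prod (𝓡 1)).prod ((𝓡 1).prod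 (𝓡 1))⟯ ((↥(Metric.sphere (0 : EuclideanSpace ℝ (Fin 2)) 1) × ↥(Metric.sphere (0 : EuclideanSpace ℝ (Fin 2)) 1)) × (↥(Metric.sphere (0 : EuclideanSpace ℝ (Fin 2)) 1) × ↥(Metric.sphere (0 : EuclideanSpace ℝ (Fin 2)) 1))))

/-- item stmt-SmoothPoincare4-10765 · crux · rank 6 · open · by planner
why it might fail: Open (Kirby 4.32, 'wide open'): a smooth S³ ⊂ S⁴ whose Schoenflies ball has no genus-≤2 / 3-handle-free structure (only cases known: Scharlemann1984, Gompf1991Killing) may be exotic; no evidence independent of SPC4 itself, and this route does not attack it.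
sources: Kirby1997, Mazur1959, Scharlemann1984, Gompf1991Killing, BudneyGabai2019
[crux] THE SMOOTH 4-DIMENSIONAL SCHOENFLIES CONJECTURE, conjunct B of X = FJ4 ∧ SCH, stated as this
route's OWN crux: verbatim the body of the Literature def
`Literature.Topology.FourManifolds.SmoothSchoenfliesConjectureFour` (equator form, Kirby list 4.32)
with the local sphere notation expanded — definitionally equal to it (`Iff.rfl`, checked in the
planner's LocalTest.lean), hence to the shared item stmt-SmoothPoincare4-0372 of routes
SchoenfliesSplit / EuclideanOrigami: a proof or refutation of either transfers by `id`. Inlined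
(route-repair 2026-08-15) because an open conjecture may enter a route's cone only as its own listed
crux or declared bridge (conjecture rule; gate deps reason undeclared-conjecture), not as a cited
Literature Prop. This route does not attack it (lowest crux rank); its engines are
CartanHadamardFour / FarrellJonesFour / TorusAbsorbsGluckTwists. Why it might fail: open since 1959
('wide open', Kirby1989 p.14): a smooth S³ ⊂ S⁴ whose Schoenflies ball has no genus-≤2 /
3-handle-free structure (the only proved cases: Scharlemann1984, Gompf1991Killing) may be exotic; no
evidence independent of SPC4. Sources: Kirby1997 (Problem 4.32), Mazur1959, Scharlemann198 -/
@[route_item "route-SmoothPoincare4-CartanHadamardSwindle", crux]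
def SmoothSchoenfliesFour : Prop :=
  ∀ f : (Metric.sphere (0 : EuclideanSpace ℝ (Fin 4)) 1) → (Metric.sphere (0 : EuclideanSpace ℝ (Fin 5)) 1), Manifold.IsSmoothEmbedding (𝓡 3) (𝓡 4) ∞ f → ∃ φ : (Metric.sphere (0 : EuclideanSpace ℝ (Fin 5)) 1) ≃ₘ⟮𝓡 4, 𝓡 4⟯ (Metric.sphere (0 : EuclideanSpace ℝ (Fin 5)) 1), φ '' Set.range f = Literature.Topology.FourManifolds.sphereFourEquator

-- item stmt-SmoothPoincare4-8138 · support · rank 5 · open · by planner — informal only, no Lean statement yet: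
--   [crux] CUBICAL FARRELL–JONES IN DIMENSION FOUR (discrete rung of route CartanHadamardSwindle,
--   two-layer plan (b)): for every closed connected hyperbolic 4-manifold X (more generally any closed
--   PL 4-manifold X carrying a locally CAT(0) cubulation, e.g. one tiled by right-angled 120-cells with
--   the dual cubulation, or T⁴ with the product cubulation) and every homotopy 4-sphere Σ there are a
--   finite cover Z → X and a closed PL 4-manifold P PL-homeomorphic to Z # Σ (PL = DIFF in dimension 4,
--   HirschMazur1974) admitting a LOCALLY CAT(0) CUBULATION: a finite cube-complex structure all of whose
--   vertex l

/-- item stmt-SmoothPoincare4-10879 · support · rank 9 · open · by planner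
[support] SCHOENFLIES FRAME over the route's own Schoenflies crux: (every punctured homotopy
4-sphere Σ ∖ {p} smoothly embeds in ℝ⁴) ∧ SmoothSchoenfliesFour → SmoothPoincare4 — the twin of the
shared frame stmt-SmoothPoincare4-0370 of route SchoenfliesSplit with the Literature conjecture
constant replaced by the definitionally equal item SmoothSchoenfliesFour (so a proof of 0370 yields
this one by `fun h hx => h ⟨hx.1, hx.2⟩`, checked in the planner's LocalTest.lean, and conversely).
Content = 0370's: the chart-sphere image bounds a Schoenflies ball; SCH makes it a ball; Σ = B⁴ ∪_φ
B⁴ is a twisted sphere; Cerf Γ₄ = 0 (tree: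
Literature.Topology.FourManifolds.cerf_twistedSphere_four, Theorems/SchoenfliesSplitAssembly.lean
schsplit_assembly_v3'); packaging into the summit binder (SchoenfliesSplit items 0517/0445/0441).
Not elementary (Cerf, Palais disc theorem, smooth Jordan–Brouwer side). Sources: Cerf1968,
Palais1960, Kirby1997, KervaireMilnor1963. [deps: SmoothSchoenfliesFour] [difficulty: L] -/
@[route_item "route-SmoothPoincare4-CartanHadamardSwindle", crux]
def SchoenfliesFrameFour : Prop :=
  ((∀ (S : Literature.Topology.FourManifolds.HomotopySphere 4) (p : S.carrier), ∃ f : (⟨{p}ᶜ, isOpen_compl_singleton⟩ : TopologicalSpace.Opens S.carrier) → EuclideanSpace ℝ (Fin 4), Manifold.IsSmoothEmbedding (𝓡 4) (𝓡 4) ∞ f) ∧ SmoothSchoenfliesFour) → SmoothPoincare4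

/-- item stmt-SmoothPoincare4-8098 · support · rank 9 · open · by planner
sources: Hatcher2002, KervaireMilnor1963, Mathlib:IsCoveringMap.existsUnique_continuousMap_lifts
[support] THE COVERING SWINDLE (card Lemma 1, host class widened): if P is a connected sum M # Σ of
a Hausdorff ℝ⁴-charted M and a homotopy 4-sphere Σ, and P admits a smooth covering map π : E → P
from a smooth 4-manifold E that smoothly embeds in ℝ⁴ (E = ℝ⁴: aspherical hosts; E = ℝ⁴ ∖ 0 ≅ S³×ℝ:
the Hopf host S¹×S³ of card hopf-stabilisation-kodaira; E = ℝ⁴ ∖ line ≅ S²×ℝ²: hosts S²×T², S²×Σ_g),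
then some punctured copy Σ ∖ {p} smoothly embeds in ℝ⁴. Proof: the punctured summand is an open
subset of P (IsOpenGluing), simply connected (hypothesis, = PuncturedSimplyConnected) and locally
path connected, so its inclusion lifts through π (Mathlib
`IsCoveringMap.existsUnique_continuousMap_lifts`); the lift is injective, open and locally (smooth
local inverse of π) ∘ (inclusion), hence a smooth embedding into E; compose with ι. [difficulty:
provable-now] -/
@[route_item "route-SmoothPoincare4-CartanHadamardSwindle", crux]
def CoveringSwindle : Prop :=
  ∀ (S : Literature.Topology.FourManifolds.HomotopySphere 4) (M P E : Type) [TopologicalSpace M] [T2Space M] [ChartedSpace (EuclideanSpace ℝ (Fin 4)) M] [TopologicalSpace P] [T2Space P] [ChartedSpace (EuclideanSpace ℝ (Fin 4)) P] [IsManifold (𝓡 4) ∞ P] [TopologicalSpace E] [ChartedSpace (EuclideanSpace ℝ (Fin 4)) E] [IsManifold (𝓡 4) ∞ E] (ι : E → EuclideanSpace ℝ (Fin 4)) (π : E → P), Manifold.IsSmoothEmbedding (𝓡 4) (𝓡 4) ∞ ι → IsCoveringMap π → Function.Surjective π → IsLocalDiffeomorph (𝓡 4) (𝓡 4) ∞ π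 → Literature.Topology.FourManifolds.IsConnectedSum (𝓡 4) (𝓡 4) (𝓡 4) M S.carrier P → (∀ p : S.carrier, SimplyConnectedSpace ({p}ᶜ : Set S.carrier)) → ∃ (p : S.carrier) (f : (⟨{p}ᶜ, isOpen_compl_singleton⟩ : TopologicalSpace.Opens S.carrier) → EuclideanSpace ℝ (Fin 4)), Manifold.IsSmoothEmbedding (𝓡 4) (𝓡 4) ∞ f

/-- item stmt-SmoothPoincare4-8099 · support · rank 9 · open · by planner
sources: Hatcher2002, Hirsch1976
[support] for every homotopy 4-sphere Σ and p ∈ Σ the open submanifold Σ ∖ {p} is simply connected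
(π₁(S⁴) = 1, Hatcher2002 Prop 1.14; deleting a point from a manifold of dimension ≥ 3 does not
change π₁ — transversality, or van Kampen for Σ = (Σ ∖ {p}) ∪ chart ball). Known; cite-level if
Mathlib lacks π₁(Sⁿ) = 1. [difficulty: M] -/
@[route_item "route-SmoothPoincare4-CartanHadamardSwindle", crux]
def PuncturedSimplyConnected : Prop :=
  ∀ (S : Literature.Topology.FourManifolds.HomotopySphere 4) (p : S.carrier), SimplyConnectedSpace ({p}ᶜ : Set S.carrier)

/-- item stmt-SmoothPoincare4-8100 · support · rank 9 · open · by planner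
sources: Milnor1965, Palais1960
[support] if Σ ∖ {p} smoothly embeds in ℝ⁴ for one point p then it does for every point q
(precompose with a diffeomorphism of Σ taking q to p — homogeneity of connected manifolds,
Milnor1965 §4; in tree the disc-theorem family
`Literature.Topology.FourManifolds.exists_diffeomorph_apply_eq_forall_isOrientationPreserving_cs`,
connectedness of Σ from Σ ≃ₕ S⁴). [difficulty: provable-now] -/
@[route_item "route-SmoothPoincare4-CartanHadamardSwindle", crux]
def PunctureHomogeneity : Prop :=
  ∀ S : Literature.Topology.FourManifolds.HomotopySphere 4, (∃ (p : S.carrier) (f : (⟨{p}ᶜ, isOpen_compl_singleton⟩ : TopologicalSpace.Opens S.carrier) → EuclideanSpace ℝ (Fin 4)), Manifold.IsSmoothEmbedding (𝓡 4) (𝓡 4) ∞ f) → ∀ p : S.carrier, ∃ f : (⟨{p}ᶜ, isOpen_compl_singleton⟩ : TopologicalSpace.Opens S.carrier) → EuclideanSpace ℝ (Fin 4), Manifold.IsSmoothEmbedding (𝓡 4) (𝓡 4) ∞ f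

/-- item stmt-SmoothPoincare4-8101 · support · rank 9 · open · by planner
sources: doi:10.2307/2044771, doi:10.1016/s0166-8641(99)00221-7
[support] there is a closed connected smooth 4-manifold with a Riemannian metric of constant
sectional curvature −1 (Davis 1985, the 120-cell manifold, χ = 26; Ratcliffe–Tschantz). Needed only
to instantiate the host in the assembly; a cite-level named fact (a Lean construction would pass
through a torsion-free subgroup of the right-angled 120-cell Coxeter group). [difficulty: L] -/
@[route_item "route-SmoothPoincare4-CartanHadamardSwindle", crux]
def ExistsClosedHyperbolicFour : Prop :=
  ∃ (X : Type) (_ : TopologicalSpace X) (_ : T2Space X) (_ : SecondCountableTopology X) (_ : ChartedSpace (EuclideanSpace ℝ (Fin 4)) X) (_ : IsManifold (𝓡 4) ∞ X) (_ : CompactSpace X) (_ : ConnectedSpace X) (g : Literature.Geometry.Lorentzian.PseudoRiemannianMetric (𝓡 4) ∞ (EuclideanSpace ℝ (Fin 4)) (TangentSpace (𝓡 4) : X → Type _)), g.IsRiemannian ∧ g.HasConstantSectionalCurvature (-1)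

-- earlier Assembly (stmt-SmoothPoincare4-8102, replaced 2026-08-15T16:54:39Z -> stmt-SmoothPoincare4-11205): retired by None — CoveringSwindle → PuncturedSimplyConnected → PunctureHomogeneity → CartanHadamardFour → ExistsClosedHyperbolicFour → FarrellJonesFour → Schoenflies → SchoenfliesFrame → SmoothPoincare4
/-- item stmt-SmoothPoincare4-11205 · assembly · rank 1 · open · by planner
sources: Lee2018, doi:10.1090/s0894-0347-1989-1002632-2, Cerf1968
[assembly] CoveringSwindle → PuncturedSimplyConnected → PunctureHomogeneity → CartanHadamardFour →
ExistsClosedHyperbolicFour → FarrellJonesFour → SmoothSchoenfliesFour → SchoenfliesFrameFour →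
SmoothPoincare4 (pure logic; = the deciding theorem `closes`, planner glue2.lean / LocalTest.lean rc
0). -/
@[route_item "route-SmoothPoincare4-CartanHadamardSwindle"]
def Assembly : Prop :=
  CoveringSwindle → PuncturedSimplyConnected → PunctureHomogeneity → CartanHadamardFour → ExistsClosedHyperbolicFour → FarrellJonesFour → SmoothSchoenfliesFour → SchoenfliesFrameFour → SmoothPoincare4

/-! D-0027 §2.1 — DECIDING THEOREM (planner-authored via `route open/edit --closes-file`; by planner-rbadge-SmoothPoincare4-CartanHadamardS-f5b59cf8-g4-0 2026-08-15T16:54:39Z):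
its hypotheses are this route's items and its conclusion the sub-problem Statement (glue_lint), and it elaborates with this file. -/

@[closes "route-SmoothPoincare4-CartanHadamardSwindle"] theorem closes (h_CoveringSwindle : CoveringSwindle) (h_PuncturedSimplyConnected : PuncturedSimplyConnected)
    (h_PunctureHomogeneity : PunctureHomogeneity) (h_CartanHadamardFour : CartanHadamardFour)
    (h_ExistsClosedHyperbolicFour : ExistsClosedHyperbolicFour) (h_FarrellJonesFour : FarrellJonesFour)
    (h_Schoenflies : SmoothSchoenfliesFour) (h_SchoenfliesFrame : SchoenfliesFrameFour) : _root_.SmoothPoincare4 := by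
  refine h_SchoenfliesFrame ⟨fun S => ?_, h_Schoenflies⟩
  obtain ⟨X, _, _, _, _, _, _, _, gX, hgR, hgC⟩ := h_ExistsClosedHyperbolicFour
  obtain ⟨Z, P, _, _, _, _, _, _, _, _, _, _, _, _, _, _, hsum, g, cov, hR, hLC, hsec⟩ :=
    h_FarrellJonesFour X gX hgR hgC S
  obtain ⟨π, hπc, hπs, hπl⟩ := h_CartanHadamardFour P g cov hR hLC hsec
  obtain ⟨p, f, hf⟩ := h_CoveringSwindle S Z P (EuclideanSpace ℝ (Fin 4)) id π
    Manifold.IsSmoothEmbedding.id hπc hπs hπl hsum (h_PuncturedSimplyConnected S)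
  exact h_PunctureHomogeneity S ⟨p, f, hf⟩

end Summit.SmoothPoincare4.SmoothPoincare4.Theses.CartanHadamardSwindle
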